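import Literature.NumberTheory.LFunctions.LFDSingleKernel
import Literature.NumberTheory.LFunctions.LogFreeDensityLocal
import Literature.NumberTheory.LFunctions.ExplicitFormulaPsiCharHeights
import HarnessLib

/-!
# Log-free zero density for one character, V: the row sums of the kernel

Topic `Literature/NumberTheory/LFunctions`, sub-namespace `LFDSingle`. Everything here is PROVED.
For the Schur bound of the Hermitian form of the Gram matrix (part IV) we need, for a finite set
`Z` of zeros `ρ' = β' + iγ'` of `L(s, χ)` with `β' ≥ 1 − λ/L`, `|γ'| ≤ T₀` (`L = log q`), and a
fixed `ρ ∈ Z`, the row sum of the kernel `g(2 − ρ − ρ̄')` of part IV. Decomposing in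
`τ = γ' − γ` into the shells `|τ| ≤ 1/L`, `2^{k-1}/L < |τ| ≤ min(2^k/L, 1)` and `m < |τ| ≤ m+1`,
counting the zeros in each shell by the local density lemma
(`LogFreeDensity.exists_sum_near_le`, radius `≤ 1/4`) or by unit windows
(`ExplicitPsiChar.exists_sum_window_le`), and using the three kernel majorants of part IV, one
gets the LOG-FREE bound (`rowSum_kernel_le`)

  `Σ_{ρ' ∈ Z} g(2 − ρ − ρ̄') ≤ C_R X^{2λ/L} L (1 + λ) (1 + log(X/Y)/L + L/log R)`.

The decay `min(2, 4/(|τ| log R))²` of the `sinc` factor is what makes the dyadic sum over `k`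
converge (`Σ_k min(4, 64L²/(4^k log²R)) ≤ 16 L/log R`).

## References
* D. R. Heath-Brown, PLMS 64 (1992), §11. [cite: HeathBrown1992PLMS, §11]
-/

noncomputable section

open Finset Real Complex
open Literature.NumberTheory.LFunctions.DirichletDisc

namespace Literature.NumberTheory.LFunctions.LFDSingle

/-! ### Counting zeros near `1 + iγ` and in unit windows -/

/-- **Local density, finite-set form**: there is an absolute `C` such that for `χ ≠ χ₀` mod `q`,
real `v`, `0 < r ≤ 1/4`, and any finite set `P` of zeros of `L(s, χ)` in `|ρ − (1 + iv)| ≤ r`,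
`Σ_{ρ ∈ P} m(ρ) ≤ C (1 + r (log q + log(|v| + 4)))`. [cite: Bombieri1987GrandCrible, §6 Lemme de densité] -/
theorem exists_sum_zeroOrder_near_le :
    ∃ C : ℝ, 0 < C ∧ ∀ (q : ℕ) [NeZero q] (χ : DirichletCharacter ℂ q), χ ≠ 1 → ∀ (v r : ℝ),
      0 < r → r ≤ 1 / 4 → ∀ P : Finset ℂ,
        (∀ ρ ∈ P, χ.LFunction ρ = 0 ∧ ‖ρ - (1 + (v : ℂ) * I)‖ ≤ r) →
          ∑ ρ ∈ P, (zeroOrder χ ρ : ℝ) ≤ C * (1 + r * (Real.log q + Real.log (|v| + 4))) := by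
  obtain ⟨C, hC, h⟩ := LogFreeDensity.exists_sum_near_le
  refine ⟨C, hC, fun q _ χ hχ v r hr hr4 P hP => ?_⟩
  classical
  set F := (discZeros χ v).filter (fun ρ => ‖ρ - (1 + (v : ℂ) * I)‖ ≤ r) with hF
  have hsub : P ⊆ F := by
    intro ρ hρ
    obtain ⟨h0, hd⟩ := hP ρ hρ
    rw [hF, mem_filter]
    refine ⟨(mem_discZeros hχ).2 ⟨?_, h0⟩, hd⟩
    rw [Metric.mem_closedBall, dist_eq_norm]
    calc ‖ρ - (2 + (v : ℂ) * I)‖ = ‖(ρ - (1 + (v : ℂ) * I)) + (-1 : ℂ)‖ := by ring_nf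
      _ ≤ ‖ρ - (1 + (v : ℂ) * I)‖ + ‖(-1 : ℂ)‖ := norm_add_le _ _
      _ ≤ 1 / 4 + 1 := by rw [norm_neg, norm_one]; linarith
      _ ≤ 81 / 50 := by norm_num
  have hball : ∀ ρ ∈ F, ρ ∈ Metric.closedBall (2 + (v : ℂ) * I) (81 / 50) := by
    intro ρ hρ
    exact ((mem_discZeros hχ).1 (mem_filter.1 hρ).1).1
  calc ∑ ρ ∈ P, (zeroOrder χ ρ : ℝ) = ∑ ρ ∈ P, ((discDivisor χ v ρ : ℤ) : ℝ) := by
        refine sum_congr rfl fun ρ hρ => ?_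
        rw [discDivisor_eq_zeroOrder hχ (hball ρ (hsub hρ))]; push_cast; rfl
    _ ≤ ∑ ρ ∈ F, ((discDivisor χ v ρ : ℤ) : ℝ) :=
        sum_le_sum_of_subset_of_nonneg hsub fun ρ _ _ => Int.cast_nonneg (discDivisor_nonneg hχ v ρ)
    _ ≤ C * (1 + r * (Real.log q + Real.log (|v| + 4))) := h q χ hχ v r hr hr4

/-- The cardinality version: `#P ≤ C(1 + r ℒ)` (each zero has `m(ρ) ≥ 1`). [folklore] -/
theorem exists_card_near_le :
    ∃ C : ℝ, 0 < C ∧ ∀ (q : ℕ) [NeZero q] (χ : DirichletCharacter ℂ q), χ ≠ 1 → ∀ (v r : ℝ),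
      0 < r → r ≤ 1 / 4 → ∀ P : Finset ℂ,
        (∀ ρ ∈ P, χ.LFunction ρ = 0 ∧ ‖ρ - (1 + (v : ℂ) * I)‖ ≤ r) →
          (P.card : ℝ) ≤ C * (1 + r * (Real.log q + Real.log (|v| + 4))) := by
  obtain ⟨C, hC, h⟩ := exists_sum_zeroOrder_near_le
  refine ⟨C, hC, fun q _ χ hχ v r hr hr4 P hP => le_trans ?_ (h q χ hχ v r hr hr4 P hP)⟩
  rw [card_eq_sum_ones]; push_cast
  refine sum_le_sum fun ρ hρ => ?_
  have := (zeroOrder_pos_iff χ hχ ρ).2 (hP ρ hρ).1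
  exact_mod_cast this

/-- Primitive characters of modulus `q > 1` are non-principal.  Duplicate of
`ExplicitPsiChar.ne_one_of_isPrimitive` (`ExplicitFormulaPsiCharZeros.lean`), kept as a deprecated
alias (dedup-01299). [folklore] -/
@[deprecated ExplicitPsiChar.ne_one_of_isPrimitive (since := "2026-08-16")]
theorem ne_one_of_isPrimitive' {q : ℕ} [NeZero q] {χ : DirichletCharacter ℂ q}
    (hprim : χ.IsPrimitive) (hq : 1 < q) : χ ≠ 1 :=
  ExplicitPsiChar.ne_one_of_isPrimitive hprim hq

/-- **Unit windows, cardinality form** (primitive `χ`, `q > 1`): `#P ≤ C (log q + log(|τ| + 4))`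
for a finite set `P` of zeros with `re ρ > 0` and `|im ρ − τ| ≤ 1/2`. [folklore] -/
theorem exists_card_window_le :
    ∃ C : ℝ, 0 < C ∧ ∀ (q : ℕ) [NeZero q] (χ : DirichletCharacter ℂ q), χ.IsPrimitive → 1 < q →
      ∀ (τ : ℝ) (P : Finset ℂ), (∀ ρ ∈ P, χ.LFunction ρ = 0 ∧ 0 < ρ.re ∧ |ρ.im - τ| ≤ 1 / 2) →
        (P.card : ℝ) ≤ C * (Real.log q + Real.log (|τ| + 4)) := by
  obtain ⟨C, hC, h⟩ := ExplicitPsiChar.exists_sum_window_le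
  refine ⟨C, hC, fun q _ χ hprim hq τ P hP => ?_⟩
  have hχ : χ ≠ 1 := ExplicitPsiChar.ne_one_of_isPrimitive hprim hq
  have hP' : ∀ ρ ∈ P, χ.LFunction ρ = 0 ∧ 0 < ρ.re ∧ ρ.re < 1 ∧ |ρ.im - τ| ≤ 1 / 2 := by
    intro ρ hρ
    obtain ⟨h0, hre, him⟩ := hP ρ hρ
    refine ⟨h0, hre, ?_, him⟩
    by_contra hre1
    exact DirichletCharacter.LFunction_ne_zero_of_one_le_re χ (Or.inl hχ) (not_lt.1 hre1) h0
  refine le_trans ?_ (h q χ hprim hq τ P hP')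
  rw [card_eq_sum_ones]; push_cast
  refine sum_le_sum fun ρ hρ => ?_
  have := (zeroOrder_pos_iff χ hχ ρ).2 (hP ρ hρ).1
  exact_mod_cast this

/-! ### Abstract layer-cake summation and elementary sums -/

/-- **Layer cake**: if every `x ∈ S` lies in some class `k ∈ K` with `f x ≤ B k` (`B ≥ 0`,
`f ≥ 0` not needed), then `Σ_{x∈S} f x ≤ Σ_{k∈K} B k · #{x ∈ S : P k x}`. [folklore] -/
theorem sum_le_sum_card_mul {ι κ : Type*} (S : Finset ι) (K : Finset κ) (f : ι → ℝ) (B : κ → ℝ)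
    (P : κ → ι → Prop) [∀ k x, Decidable (P k x)] (hB : ∀ k ∈ K, 0 ≤ B k)
    (h : ∀ x ∈ S, ∃ k ∈ K, P k x ∧ f x ≤ B k) :
    ∑ x ∈ S, f x ≤ ∑ k ∈ K, B k * ((S.filter (P k)).card : ℝ) := by
  have hpt : ∀ x ∈ S, f x ≤ ∑ k ∈ K, if P k x then B k else 0 := by
    intro x hx
    obtain ⟨k, hk, hPk, hfx⟩ := h x hx
    calc f x ≤ B k := hfx
      _ = if P k x then B k else 0 := by rw [if_pos hPk]
      _ ≤ ∑ k ∈ K, if P k x then B k else 0 :=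
          single_le_sum (f := fun k => if P k x then B k else 0)
            (fun k' hk' => by split_ifs <;> [exact hB k' hk'; exact le_rfl]) hk
  calc ∑ x ∈ S, f x ≤ ∑ x ∈ S, ∑ k ∈ K, (if P k x then B k else 0) := sum_le_sum hpt
    _ = ∑ k ∈ K, ∑ x ∈ S, (if P k x then B k else 0) := sum_comm
    _ = ∑ k ∈ K, B k * ((S.filter (P k)).card : ℝ) := by
        refine sum_congr rfl fun k _ => ?_
        rw [← sum_filter, sum_const, nsmul_eq_mul, mul_comm]

/-- A dyadic index for `t ∈ (1/L, 1]`: some `1 ≤ k ≤ ⌊L⌋ + 1` with `2^{k-1}/L < t ≤ 2^k/L`.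
[folklore] -/
theorem exists_dyadic_index {L t : ℝ} (hL : 1 ≤ L) (h1 : 1 / L < t) (h2 : t ≤ 1) :
    ∃ k : ℕ, 1 ≤ k ∧ k ≤ ⌊L⌋₊ + 1 ∧ (2 : ℝ) ^ (k - 1) / L < t ∧ t ≤ (2 : ℝ) ^ k / L := by
  classical
  have hL0 : 0 < L := by linarith
  have hex : ∃ k : ℕ, t ≤ (2 : ℝ) ^ k / L := by
    refine ⟨⌊L⌋₊ + 1, ?_⟩
    rw [le_div_iff₀ hL0]
    have h3 : L < (⌊L⌋₊ + 1 : ℕ) := by push_cast; exact Nat.lt_floor_add_one L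
    have h4 : ((⌊L⌋₊ + 1 : ℕ) : ℝ) ≤ (2 : ℝ) ^ (⌊L⌋₊ + 1) := by
      exact_mod_cast (Nat.lt_two_pow_self).le
    nlinarith
  set k := Nat.find hex with hk
  have hk_spec : t ≤ (2 : ℝ) ^ k / L := Nat.find_spec hex
  have hk1 : 1 ≤ k := by
    by_contra h0
    have : k = 0 := by omega
    rw [this, pow_zero] at hk_spec
    linarith
  refine ⟨k, hk1, ?_, ?_, hk_spec⟩
  · exact Nat.find_le (by
      rw [le_div_iff₀ hL0]
      have h3 : L < (⌊L⌋₊ + 1 : ℕ) := by push_cast; exact Nat.lt_floor_add_one L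
      have h4 : ((⌊L⌋₊ + 1 : ℕ) : ℝ) ≤ (2 : ℝ) ^ (⌊L⌋₊ + 1) := by
        exact_mod_cast (Nat.lt_two_pow_self).le
      nlinarith)
  · have hmin := Nat.find_min hex (m := k - 1) (by omega)
    push Not at hmin
    exact hmin

/-- A unit index for `t ∈ (1, T]`: some `1 ≤ m ≤ ⌊T⌋` with `m < t ≤ m + 1`. [folklore] -/
theorem exists_unit_index {t T : ℝ} (h1 : 1 < t) (h2 : t ≤ T) :
    ∃ m : ℕ, 1 ≤ m ∧ m ≤ ⌊T⌋₊ ∧ (m : ℝ) < t ∧ t ≤ m + 1 := by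
  refine ⟨⌈t⌉₊ - 1, ?_, ?_, ?_, ?_⟩
  · have : 2 ≤ ⌈t⌉₊ := Nat.lt_ceil.2 (by push_cast; linarith)
    omega
  · have h3 : ⌈t⌉₊ ≤ ⌊T⌋₊ + 1 := by
      have h4 : (⌈t⌉₊ : ℝ) < t + 1 := Nat.ceil_lt_add_one (by linarith)
      have h5 : (⌈t⌉₊ : ℝ) < ⌊T⌋₊ + 1 + 1 := by
        have := Nat.lt_floor_add_one T; linarith
      have h6 : ⌈t⌉₊ < ⌊T⌋₊ + 1 + 1 := by exact_mod_cast h5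
      omega
    omega
  · have h2' : 2 ≤ ⌈t⌉₊ := Nat.lt_ceil.2 (by push_cast; linarith)
    have : ((⌈t⌉₊ - 1 : ℕ) : ℝ) = ⌈t⌉₊ - 1 := by
      rw [Nat.cast_sub (by omega)]; push_cast; ring
    rw [this]
    have := Nat.ceil_lt_add_one (by linarith : (0 : ℝ) ≤ t)
    linarith
  · have h2' : 2 ≤ ⌈t⌉₊ := Nat.lt_ceil.2 (by push_cast; linarith)
    have : ((⌈t⌉₊ - 1 : ℕ) : ℝ) = ⌈t⌉₊ - 1 := by
      rw [Nat.cast_sub (by omega)]; push_cast; ring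
    rw [this]
    have := Nat.le_ceil t
    linarith

/-- `Σ_{k ∈ Icc 1 K} 2^{1-k} ≤ 2`. [folklore] -/
theorem sum_two_pow_neg_le (K : ℕ) : ∑ k ∈ Icc 1 K, (2 : ℝ) ^ (1 - (k : ℤ)) ≤ 2 := by
  have h : ∀ n : ℕ, ∑ k ∈ Icc 1 n, (2 : ℝ) ^ (1 - (k : ℤ)) = 2 - (2 : ℝ) ^ (1 - (n : ℤ)) := by
    intro n
    induction n with
    | zero => simp
    | succ n ih =>
      rw [sum_Icc_succ_top (by omega), ih]
      push_cast
      rw [show (1 : ℤ) - (n + 1) = (1 - n) - 1 by ring, zpow_sub_one₀ (by norm_num)]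
      ring
  rw [h]
  have : 0 < (2 : ℝ) ^ (1 - (K : ℤ)) := zpow_pos (by norm_num) _
  linarith

/-- `min(4, c/4^k) ≤ 2√c / 2^k` (`c ≥ 0`). [folklore] -/
theorem min_four_le {c : ℝ} (hc : 0 ≤ c) (k : ℕ) :
    min 4 (c / (4 : ℝ) ^ k) ≤ 2 * Real.sqrt c / (2 : ℝ) ^ k := by
  have h4 : (4 : ℝ) ^ k = ((2 : ℝ) ^ k) ^ 2 := by
    rw [← pow_mul, mul_comm, pow_mul]; norm_num
  have h2k : 0 < (2 : ℝ) ^ k := by positivity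
  set a : ℝ := Real.sqrt c / (2 : ℝ) ^ k with ha
  have ha0 : 0 ≤ a := by positivity
  have hca : c / (4 : ℝ) ^ k = a ^ 2 := by
    rw [ha, div_pow, Real.sq_sqrt hc, h4]
  rw [hca, show 2 * Real.sqrt c / (2 : ℝ) ^ k = 2 * a by rw [ha]; ring]
  -- `min(4, a²) ≤ 2a`
  rcases le_or_gt a 2 with h | h
  · calc min 4 (a ^ 2) ≤ a ^ 2 := min_le_right _ _
      _ ≤ 2 * a := by nlinarith
  · calc min 4 (a ^ 2) ≤ 4 := min_le_left _ _
      _ ≤ 2 * a := by linarith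

/-- `Σ_{k ∈ Icc 1 K} min(4, c/4^k) ≤ 2√c`. [folklore] -/
theorem sum_min_four_le {c : ℝ} (hc : 0 ≤ c) (K : ℕ) :
    ∑ k ∈ Icc 1 K, min 4 (c / (4 : ℝ) ^ k) ≤ 2 * Real.sqrt c := by
  calc ∑ k ∈ Icc 1 K, min 4 (c / (4 : ℝ) ^ k) ≤ ∑ k ∈ Icc 1 K, 2 * Real.sqrt c / (2 : ℝ) ^ k :=
        sum_le_sum fun k _ => min_four_le hc k
    _ = Real.sqrt c * ∑ k ∈ Icc 1 K, (2 : ℝ) ^ (1 - (k : ℤ)) := by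
        rw [mul_sum]
        refine sum_congr rfl fun k _ => ?_
        rw [zpow_sub₀ (by norm_num), zpow_one, zpow_natCast]
        field_simp
    _ ≤ Real.sqrt c * 2 := mul_le_mul_of_nonneg_left (sum_two_pow_neg_le K) (Real.sqrt_nonneg _)
    _ = 2 * Real.sqrt c := by ring

/-- `(2 + m)^{3/2} e^{-πm/2} ≤ 16 e^{-m}`. [folklore] -/
theorem rpow_mul_exp_le_sixteen (m : ℕ) :
    ((2 : ℝ) + m) ^ (3 / 2 : ℝ) * Real.exp (-(π * m) / 2) ≤ 16 * Real.exp (-(m : ℝ)) := by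
  have hm : (0 : ℝ) ≤ m := Nat.cast_nonneg m
  have h1 : ((2 : ℝ) + m) ^ (3 / 2 : ℝ) ≤ ((2 : ℝ) + m) ^ (2 : ℝ) :=
    Real.rpow_le_rpow_of_exponent_le (by linarith) (by norm_num)
  have h2 : ((2 : ℝ) + m) ^ (2 : ℝ) = (2 + m) ^ 2 := by
    rw [show (2 : ℝ) = ((2 : ℕ) : ℝ) by norm_num, Real.rpow_natCast]
  have h3 : (2 + (m : ℝ)) ≤ 4 * Real.exp (m / 4) := by
    have := Real.add_one_le_exp ((m : ℝ) / 4); linarith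
  have h4 : (2 + (m : ℝ)) ^ 2 ≤ 16 * Real.exp (m / 2) := by
    calc (2 + (m : ℝ)) ^ 2 ≤ (4 * Real.exp (m / 4)) ^ 2 := by gcongr
      _ = 16 * Real.exp (m / 2) := by
          rw [mul_pow, ← Real.exp_nat_mul]; norm_num; ring_nf
  have h5 : Real.exp ((m : ℝ) / 2) * Real.exp (-(π * m) / 2) ≤ Real.exp (-(m : ℝ)) := by
    rw [← Real.exp_add, Real.exp_le_exp]
    have := Real.pi_gt_three
    nlinarith
  calc ((2 : ℝ) + m) ^ (3 / 2 : ℝ) * Real.exp (-(π * m) / 2)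
      ≤ (2 + (m : ℝ)) ^ 2 * Real.exp (-(π * m) / 2) := by
        rw [← h2]; exact mul_le_mul_of_nonneg_right h1 (Real.exp_nonneg _)
    _ ≤ 16 * Real.exp (m / 2) * Real.exp (-(π * m) / 2) :=
        mul_le_mul_of_nonneg_right h4 (Real.exp_nonneg _)
    _ = 16 * (Real.exp (m / 2) * Real.exp (-(π * m) / 2)) := by ring
    _ ≤ 16 * Real.exp (-(m : ℝ)) := mul_le_mul_of_nonneg_left h5 (by norm_num)

/-- `Σ_{m ∈ Icc 1 M} e^{-m} ≤ e⁻¹/(1 − e⁻¹)`. [folklore] -/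
theorem sum_exp_neg_le (M : ℕ) :
    ∑ m ∈ Icc 1 M, Real.exp (-(m : ℝ)) ≤ Real.exp (-1) / (1 - Real.exp (-1)) := by
  have hr0 : 0 ≤ Real.exp (-1) := Real.exp_nonneg _
  have hr1 : Real.exp (-1) < 1 := Real.exp_lt_one_iff.2 (by norm_num)
  have heq : ∑ m ∈ Icc 1 M, Real.exp (-(m : ℝ)) = ∑ m ∈ Ico 1 (M + 1), Real.exp (-1) ^ m := by
    rw [show Icc 1 M = Ico 1 (M + 1) from rfl]
    refine sum_congr rfl fun m _ => ?_
    rw [← Real.exp_nat_mul]; ring_nf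
  rw [heq]
  have := geom_sum_Ico_le_of_lt_one (m := 1) (n := M + 1) hr0 hr1
  rwa [pow_one] at this

/-- `Σ_{m ∈ Icc 1 M} (2+m)^{3/2} e^{-πm/2} ≤ 10`. [folklore] -/
theorem sum_rpow_mul_exp_le_ten (M : ℕ) :
    ∑ m ∈ Icc 1 M, ((2 : ℝ) + m) ^ (3 / 2 : ℝ) * Real.exp (-(π * m) / 2) ≤ 10 := by
  have h1 : ∑ m ∈ Icc 1 M, ((2 : ℝ) + m) ^ (3 / 2 : ℝ) * Real.exp (-(π * m) / 2) ≤
      ∑ m ∈ Icc 1 M, 16 * Real.exp (-(m : ℝ)) := sum_le_sum fun m _ => rpow_mul_exp_le_sixteen m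
  have h2 := sum_exp_neg_le M
  have he : Real.exp (-1) ≤ 3 / 8 := by
    rw [Real.exp_neg]
    have h := Real.exp_one_gt_d9
    rw [inv_le_comm₀ (Real.exp_pos 1) (by norm_num)]
    linarith
  have h3 : Real.exp (-1) / (1 - Real.exp (-1)) ≤ 3 / 5 := by
    rw [div_le_iff₀ (by linarith)]; linarith
  rw [← mul_sum] at h1
  linarith

/-! ### The shell counts for a set of zeros near `σ = 1` -/

section Counts

variable {q : ℕ} [NeZero q] {χ : DirichletCharacter ℂ q}

/-- **Near shells by local density**: for `χ ≠ χ₀`, zeros with `β' ≥ 1 − λ/L` and `|γ' − γ| ≤ δ`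
lie within `δ + λ/L` of `1 + iγ`; so if `δ + λ/L ≤ 1/4`, their number is
`≤ C_loc (1 + (δ + λ/L)(log q + log(|γ| + 4)))`. [folklore] -/
theorem card_filter_near_le {C : ℝ}
    (hC : ∀ (q : ℕ) [NeZero q] (χ : DirichletCharacter ℂ q), χ ≠ 1 → ∀ (v r : ℝ),
      0 < r → r ≤ 1 / 4 → ∀ P : Finset ℂ,
        (∀ ρ ∈ P, χ.LFunction ρ = 0 ∧ ‖ρ - (1 + (v : ℂ) * I)‖ ≤ r) →
          (P.card : ℝ) ≤ C * (1 + r * (Real.log q + Real.log (|v| + 4))))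
    (hχ : χ ≠ 1) {L lam : ℝ} (hL : 0 < L) (hlam : 0 ≤ lam) {Z : Finset ℂ}
    (hZ : ∀ ρ ∈ Z, χ.LFunction ρ = 0 ∧ 1 - lam / L ≤ ρ.re) (γ : ℝ) {δ : ℝ} (hδ : 0 < δ)
    (hr : δ + lam / L ≤ 1 / 4) :
    ((Z.filter (fun ρ' => |ρ'.im - γ| ≤ δ)).card : ℝ) ≤
      C * (1 + (δ + lam / L) * (Real.log q + Real.log (|γ| + 4))) := by
  refine hC q χ hχ γ (δ + lam / L) (by positivity) hr _ fun ρ' hρ' => ?_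
  rw [mem_filter] at hρ'
  obtain ⟨h0, hre⟩ := hZ ρ' hρ'.1
  refine ⟨h0, ?_⟩
  have hre1 : ρ'.re < 1 := by
    by_contra h
    exact DirichletCharacter.LFunction_ne_zero_of_one_le_re χ (Or.inl hχ) (not_lt.1 h) h0
  calc ‖ρ' - (1 + (γ : ℂ) * I)‖ ≤ |(ρ' - (1 + (γ : ℂ) * I)).re| + |(ρ' - (1 + (γ : ℂ) * I)).im| :=
        Complex.norm_le_abs_re_add_abs_im _
    _ = (1 - ρ'.re) + |ρ'.im - γ| := by
        simp only [Complex.sub_re, Complex.add_re, Complex.one_re, Complex.mul_re, Complex.ofReal_re,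
          Complex.I_re, mul_zero, Complex.ofReal_im, Complex.I_im, mul_one, sub_self, add_zero,
          Complex.sub_im, Complex.add_im, Complex.one_im, Complex.mul_im, zero_add]
        rw [abs_of_nonpos (by linarith)]; ring
    _ ≤ lam / L + δ := by
        have : 1 - ρ'.re ≤ lam / L := by linarith
        linarith [hρ'.2]
    _ = δ + lam / L := add_comm _ _

/-- **Unit-width shells by windows** (primitive `χ`, `q > 1`): the zeros of `Z` (all with
`re ρ > 0`) with `a ≤ γ' ≤ a + 1` number at most `C_w (log q + log(|a + 1/2| + 4))`. [folklore] -/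
theorem card_filter_Icc_le {C : ℝ}
    (hC : ∀ (q : ℕ) [NeZero q] (χ : DirichletCharacter ℂ q), χ.IsPrimitive → 1 < q →
      ∀ (τ : ℝ) (P : Finset ℂ), (∀ ρ ∈ P, χ.LFunction ρ = 0 ∧ 0 < ρ.re ∧ |ρ.im - τ| ≤ 1 / 2) →
        (P.card : ℝ) ≤ C * (Real.log q + Real.log (|τ| + 4)))
    (hprim : χ.IsPrimitive) (hq : 1 < q) {Z : Finset ℂ}
    (hZ : ∀ ρ ∈ Z, χ.LFunction ρ = 0 ∧ 0 < ρ.re) (a : ℝ) :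
    ((Z.filter (fun ρ' => a ≤ ρ'.im ∧ ρ'.im ≤ a + 1)).card : ℝ) ≤
      C * (Real.log q + Real.log (|a + 1 / 2| + 4)) := by
  refine hC q χ hprim hq (a + 1 / 2) _ fun ρ' hρ' => ?_
  rw [mem_filter] at hρ'
  obtain ⟨h0, hre⟩ := hZ ρ' hρ'.1
  exact ⟨h0, hre, abs_le.2 ⟨by linarith [hρ'.2.1], by linarith [hρ'.2.2]⟩⟩

/-- Two windows: zeros with `m < |γ' − γ| ≤ m + 1` number at most
`2 C_w (log q + log(|γ| + m + 5))` (`m ≥ 0`). [folklore] -/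
theorem card_filter_unitShell_le {C : ℝ} (hC0 : 0 ≤ C)
    (hC : ∀ (q : ℕ) [NeZero q] (χ : DirichletCharacter ℂ q), χ.IsPrimitive → 1 < q →
      ∀ (τ : ℝ) (P : Finset ℂ), (∀ ρ ∈ P, χ.LFunction ρ = 0 ∧ 0 < ρ.re ∧ |ρ.im - τ| ≤ 1 / 2) →
        (P.card : ℝ) ≤ C * (Real.log q + Real.log (|τ| + 4)))
    (hprim : χ.IsPrimitive) (hq : 1 < q) {Z : Finset ℂ}
    (hZ : ∀ ρ ∈ Z, χ.LFunction ρ = 0 ∧ 0 < ρ.re) (γ : ℝ) {m : ℝ} (hm : 0 ≤ m) :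
    ((Z.filter (fun ρ' => m < |ρ'.im - γ| ∧ |ρ'.im - γ| ≤ m + 1)).card : ℝ) ≤
      2 * C * (Real.log q + Real.log (|γ| + m + 5)) := by
  classical
  have hq1 : (1 : ℝ) ≤ q := by exact_mod_cast hq.le
  have hlogq : 0 ≤ Real.log q := Real.log_nonneg hq1
  -- the two windows `[γ + m, γ + m + 1]` and `[γ - m - 1, γ - m]`
  set A := Z.filter (fun ρ' => γ + m ≤ ρ'.im ∧ ρ'.im ≤ γ + m + 1) with hA
  set B := Z.filter (fun ρ' => γ - m - 1 ≤ ρ'.im ∧ ρ'.im ≤ γ - m - 1 + 1) with hB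
  have hsub : Z.filter (fun ρ' => m < |ρ'.im - γ| ∧ |ρ'.im - γ| ≤ m + 1) ⊆ A ∪ B := by
    intro ρ' hρ'
    rw [mem_filter] at hρ'
    obtain ⟨hZ', h1, h2⟩ := hρ'
    rw [mem_union, hA, hB, mem_filter, mem_filter]
    rcases le_or_gt 0 (ρ'.im - γ) with h | h
    · rw [abs_of_nonneg h] at h1 h2
      exact Or.inl ⟨hZ', by linarith, by linarith⟩
    · rw [abs_of_neg h] at h1 h2
      exact Or.inr ⟨hZ', by linarith, by linarith⟩
  have hA' := card_filter_Icc_le hC hprim hq hZ (γ + m)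
  have hB' := card_filter_Icc_le hC hprim hq hZ (γ - m - 1)
  rw [← hA] at hA'
  rw [← hB] at hB'
  -- `log(|center| + 4) ≤ log(|γ| + m + 5)`
  have hlogA : Real.log (|γ + m + 1 / 2| + 4) ≤ Real.log (|γ| + m + 5) := by
    refine Real.log_le_log (by positivity) ?_
    have := abs_add_le γ (m + 1 / 2)
    rw [abs_of_nonneg (by linarith : (0:ℝ) ≤ m + 1 / 2)] at this
    rw [show γ + m + 1 / 2 = γ + (m + 1 / 2) by ring]; linarith
  have hlogB : Real.log (|γ - m - 1 + 1 / 2| + 4) ≤ Real.log (|γ| + m + 5) := by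
    refine Real.log_le_log (by positivity) ?_
    have := abs_sub γ (m + 1 / 2)
    rw [abs_of_nonneg (by linarith : (0:ℝ) ≤ m + 1 / 2)] at this
    rw [show γ - m - 1 + 1 / 2 = γ - (m + 1 / 2) by ring]; linarith
  calc ((Z.filter (fun ρ' => m < |ρ'.im - γ| ∧ |ρ'.im - γ| ≤ m + 1)).card : ℝ)
      ≤ ((A ∪ B).card : ℝ) := by exact_mod_cast card_le_card hsub
    _ ≤ (A.card : ℝ) + B.card := by exact_mod_cast card_union_le A B
    _ ≤ C * (Real.log q + Real.log (|γ + m + 1 / 2| + 4)) +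
          C * (Real.log q + Real.log (|γ - m - 1 + 1 / 2| + 4)) := add_le_add hA' hB'
    _ ≤ C * (Real.log q + Real.log (|γ| + m + 5)) + C * (Real.log q + Real.log (|γ| + m + 5)) := by
        gcongr
    _ = 2 * C * (Real.log q + Real.log (|γ| + m + 5)) := by ring

/-- Zeros with `|γ' − γ| ≤ 1` number at most `2 C_w (log q + log(|γ| + 5))`. [folklore] -/
theorem card_filter_one_le {C : ℝ} (hC0 : 0 ≤ C)
    (hC : ∀ (q : ℕ) [NeZero q] (χ : DirichletCharacter ℂ q), χ.IsPrimitive → 1 < q →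
      ∀ (τ : ℝ) (P : Finset ℂ), (∀ ρ ∈ P, χ.LFunction ρ = 0 ∧ 0 < ρ.re ∧ |ρ.im - τ| ≤ 1 / 2) →
        (P.card : ℝ) ≤ C * (Real.log q + Real.log (|τ| + 4)))
    (hprim : χ.IsPrimitive) (hq : 1 < q) {Z : Finset ℂ}
    (hZ : ∀ ρ ∈ Z, χ.LFunction ρ = 0 ∧ 0 < ρ.re) (γ : ℝ) :
    ((Z.filter (fun ρ' => |ρ'.im - γ| ≤ 1)).card : ℝ) ≤
      2 * C * (Real.log q + Real.log (|γ| + 5)) := by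
  classical
  set A := Z.filter (fun ρ' => γ ≤ ρ'.im ∧ ρ'.im ≤ γ + 1) with hA
  set B := Z.filter (fun ρ' => γ - 1 ≤ ρ'.im ∧ ρ'.im ≤ γ - 1 + 1) with hB
  have hsub : Z.filter (fun ρ' => |ρ'.im - γ| ≤ 1) ⊆ A ∪ B := by
    intro ρ' hρ'
    rw [mem_filter] at hρ'
    obtain ⟨hZ', h1⟩ := hρ'
    rw [abs_le] at h1
    rw [mem_union, hA, hB, mem_filter, mem_filter]
    rcases le_or_gt γ ρ'.im with h | h
    · exact Or.inl ⟨hZ', h, by linarith [h1.2]⟩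
    · exact Or.inr ⟨hZ', by linarith [h1.1], by linarith⟩
  have hA' := card_filter_Icc_le hC hprim hq hZ γ
  have hB' := card_filter_Icc_le hC hprim hq hZ (γ - 1)
  rw [← hA] at hA'
  rw [← hB] at hB'
  have hlogA : Real.log (|γ + 1 / 2| + 4) ≤ Real.log (|γ| + 5) := by
    refine Real.log_le_log (by positivity) ?_
    have := abs_add_le γ (1 / 2)
    rw [abs_of_nonneg (by norm_num : (0:ℝ) ≤ 1 / 2)] at this; linarith
  have hlogB : Real.log (|γ - 1 + 1 / 2| + 4) ≤ Real.log (|γ| + 5) := by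
    refine Real.log_le_log (by positivity) ?_
    have := abs_sub γ (1 / 2)
    rw [abs_of_nonneg (by norm_num : (0:ℝ) ≤ 1 / 2)] at this
    rw [show γ - 1 + 1 / 2 = γ - 1 / 2 by ring]; linarith
  calc ((Z.filter (fun ρ' => |ρ'.im - γ| ≤ 1)).card : ℝ)
      ≤ ((A ∪ B).card : ℝ) := by exact_mod_cast card_le_card hsub
    _ ≤ (A.card : ℝ) + B.card := by exact_mod_cast card_union_le A B
    _ ≤ C * (Real.log q + Real.log (|γ + 1 / 2| + 4)) +
          C * (Real.log q + Real.log (|γ - 1 + 1 / 2| + 4)) := add_le_add hA' hB'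
    _ ≤ C * (Real.log q + Real.log (|γ| + 5)) + C * (Real.log q + Real.log (|γ| + 5)) := by gcongr
    _ = 2 * C * (Real.log q + Real.log (|γ| + 5)) := by ring

end Counts

/-! ### The row sums -/

/-- The argument `w₁ = 2 − ρ − ρ̄'` of the kernel: real and imaginary parts. [folklore] -/
theorem re_im_two_sub (ρ ρ' : ℂ) :
    (2 - ρ - (starRingEnd ℂ) ρ').re = 2 - ρ.re - ρ'.re ∧ (2 - ρ - (starRingEnd ℂ) ρ').im = ρ'.im - ρ.im := by
  constructor
  · simp [Complex.sub_re]
  · simp [Complex.sub_im]; ring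

set_option maxHeartbeats 6000000 in
/-- **The row sums of the kernel are log-free.** There is an absolute `C_R` such that for a
primitive `χ` mod `q` with `L = log q ≥ 40`, parameters `1 ≤ Y ≤ X`, `R > 1`, `J ≥ 4 log R`,
`0 ≤ λ ≤ L/16`, `T₀ ≥ 0` with `log(T₀ + 4) ≤ L/4`, and any finite set `Z` of zeros of `L(s, χ)` with
`β ≥ 1 − λ/L`, `|γ| ≤ T₀`: for every `ρ ∈ Z`,
`Σ_{ρ' ∈ Z} g(2 − ρ − ρ̄') ≤ C_R X^{2λ/L} L (1 + λ)(1 + log(X/Y)/L + L/log R)`.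
[cite: HeathBrown1992PLMS, §11] -/
theorem rowSum_kernel_le :
    ∃ C_R : ℝ, 0 < C_R ∧ ∀ (q : ℕ) [NeZero q] (χ : DirichletCharacter ℂ q), χ.IsPrimitive → 1 < q →
      40 ≤ Real.log q →
      ∀ (X Y R : ℝ) (J : ℕ), 1 ≤ Y → Y ≤ X → 1 < R → 0 < J → 4 * Real.log R ≤ J →
      ∀ (lam T₀ : ℝ), 0 ≤ lam → lam ≤ Real.log q / 16 → 0 ≤ T₀ →
        Real.log (T₀ + 4) ≤ Real.log q / 4 →
      ∀ Z : Finset ℂ, (∀ ρ ∈ Z, χ.LFunction ρ = 0 ∧ 1 - lam / Real.log q ≤ ρ.re ∧ |ρ.im| ≤ T₀) →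
      ∀ ρ ∈ Z, ∑ ρ' ∈ Z, kernel X Y R J (2 - ρ - (starRingEnd ℂ) ρ') ≤
        C_R * X ^ (2 * lam / Real.log q) * Real.log q * (1 + lam) *
          (1 + Real.log (X / Y) / Real.log q + Real.log q / Real.log R) := by
  obtain ⟨C_loc, hC_loc, hloc⟩ := exists_card_near_le
  obtain ⟨C_w, hC_w, hwin⟩ := exists_card_window_le
  refine ⟨π ^ 2 * (4272 * C_loc + 49920 * C_w) + 1, by positivity, ?_⟩
  intro q _ χ hprim hq hL40 X Y R J hY1 hYX hR hJ hJR lam T₀ hlam hlamL hT₀ hT₀L Z hZ ρ hρ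
  classical
  have hχ : χ ≠ 1 := ExplicitPsiChar.ne_one_of_isPrimitive hprim hq
  set L : ℝ := Real.log q with hLdef
  have hL0 : 0 < L := by linarith
  have hL1 : 1 ≤ L := by linarith
  have hX1 : 1 ≤ X := hY1.trans hYX
  have hlogR : 0 < Real.log R := Real.log_pos hR
  set ℓR : ℝ := Real.log R with hℓR
  set ε : ℝ := 2 * lam / L with hε
  have hε0 : 0 ≤ ε := by rw [hε]; positivity
  set Xe : ℝ := X ^ ε with hXe
  have hXe1 : 1 ≤ Xe := Real.one_le_rpow hX1 hε0
  have hlamL' : lam / L ≤ 1 / 16 := by rw [div_le_iff₀ hL0]; linarith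
  -- data of `ρ`
  obtain ⟨hρ0, hρre, hρim⟩ := hZ ρ hρ
  set γ : ℝ := ρ.im with hγ
  have hρre1 : ρ.re < 1 := by
    by_contra h
    exact DirichletCharacter.LFunction_ne_zero_of_one_le_re χ (Or.inl hχ) (not_lt.1 h) hρ0
  have hlogγ : Real.log (|γ| + 4) ≤ L / 4 :=
    (Real.log_le_log (by positivity) (by linarith)).trans hT₀L
  have hZre : ∀ ρ' ∈ Z, χ.LFunction ρ' = 0 ∧ 1 - lam / L ≤ ρ'.re := fun ρ' h => ⟨(hZ ρ' h).1, (hZ ρ' h).2.1⟩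
  have hZpos : ∀ ρ' ∈ Z, χ.LFunction ρ' = 0 ∧ 0 < ρ'.re := fun ρ' h =>
    ⟨(hZ ρ' h).1, by linarith [(hZ ρ' h).2.1]⟩
  -- the argument `w` and its real part
  have hw : ∀ ρ' ∈ Z, 0 < (2 - ρ - (starRingEnd ℂ) ρ').re ∧ (2 - ρ - (starRingEnd ℂ) ρ').re ≤ 1 ∧
      (2 - ρ - (starRingEnd ℂ) ρ').re ≤ ε ∧ (2 - ρ - (starRingEnd ℂ) ρ').im = ρ'.im - γ ∧
      X ^ (2 - ρ - (starRingEnd ℂ) ρ').re ≤ Xe := by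
    intro ρ' hρ'
    obtain ⟨h0', hre', -⟩ := hZ ρ' hρ'
    have hre1' : ρ'.re < 1 := by
      by_contra h
      exact DirichletCharacter.LFunction_ne_zero_of_one_le_re χ (Or.inl hχ) (not_lt.1 h) h0'
    obtain ⟨hwre, hwim⟩ := re_im_two_sub ρ ρ'
    rw [hwre, hwim]
    have h3 : 2 - ρ.re - ρ'.re ≤ ε := by
      rw [hε, mul_div_assoc]; have := hρre; have := hre'; linarith
    refine ⟨by linarith, by linarith, h3, rfl, ?_⟩
    exact Real.rpow_le_rpow_of_exponent_le hX1 h3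
  /- ### pointwise bounds on the three ranges -/
  set B₀ : ℝ := 192 * π ^ 2 * Real.log (X / Y) * Xe with hB₀
  set Bk : ℕ → ℝ := fun k => 96 * π ^ 2 * Xe * (L / (2 : ℝ) ^ (k - 1)) *
    (min 2 (4 * L / ((2 : ℝ) ^ (k - 1) * ℓR))) ^ 2 with hBk
  set Bm : ℕ → ℝ := fun m => 128 * π ^ 2 * Xe * (((2 : ℝ) + m) ^ (3 / 2 : ℝ) * Real.exp (-(π * m) / 2)) with hBm
  have hlogXY : 0 ≤ Real.log (X / Y) := Real.log_nonneg ((one_le_div (by linarith)).2 hYX)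
  have hB₀0 : 0 ≤ B₀ := by rw [hB₀]; positivity
  have hBk0 : ∀ k, 0 ≤ Bk k := fun k => by simp only [hBk]; positivity
  have hBm0 : ∀ m, 0 ≤ Bm m := fun m => by simp only [hBm]; positivity
  -- (i) `|τ| ≤ 1/L`
  have hpt0 : ∀ ρ' ∈ Z, |ρ'.im - γ| ≤ 1 / L → kernel X Y R J (2 - ρ - (starRingEnd ℂ) ρ') ≤ B₀ := by
    intro ρ' hρ' hτ
    obtain ⟨hw0, hw1, hwε, hwim, hXw⟩ := hw ρ' hρ'
    have h1L : 1 / L ≤ 1 := by rw [div_le_one hL0]; exact hL1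
    refine (kernel_le_small hY1 hYX hR.le hJ hw0 hw1 (by rw [hwim]; linarith)).trans ?_
    rw [hB₀]
    exact mul_le_mul_of_nonneg_left hXw (by positivity)
  -- (ii) `1/L < |τ| ≤ 1`
  set K₀ : ℕ := ⌊L⌋₊ + 1 with hK₀
  have hpt1 : ∀ ρ' ∈ Z, 1 / L < |ρ'.im - γ| → |ρ'.im - γ| ≤ 1 →
      ∃ k ∈ Icc 1 K₀, ((2 : ℝ) ^ (k - 1) / L < |ρ'.im - γ| ∧ |ρ'.im - γ| ≤ (2 : ℝ) ^ k / L) ∧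
        kernel X Y R J (2 - ρ - (starRingEnd ℂ) ρ') ≤ Bk k := by
    intro ρ' hρ' h1 h2
    obtain ⟨k, hk1, hkK, hlo, hhi⟩ := exists_dyadic_index hL1 h1 h2
    refine ⟨k, mem_Icc.2 ⟨hk1, hkK⟩, ⟨hlo, hhi⟩, ?_⟩
    obtain ⟨hw0, hw1, hwε, hwim, hXw⟩ := hw ρ' hρ'
    have hτ0 : 0 < |ρ'.im - γ| := lt_trans (by positivity) h1
    have him0 : (2 - ρ - (starRingEnd ℂ) ρ').im ≠ 0 := by
      rw [hwim]; intro h; rw [h, abs_zero] at hτ0; exact lt_irrefl _ hτ0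
    refine (kernel_le_mid hY1 hYX hR hJ hJR hw0 hw1 (by rw [hwim]; exact h2) him0).trans ?_
    rw [hwim]
    simp only [hBk]
    have h2k : 0 < (2 : ℝ) ^ (k - 1) := by positivity
    -- `1/|τ| ≤ L/2^{k-1}` and the `min` is monotone
    have hinv : X ^ (2 - ρ - (starRingEnd ℂ) ρ').re / |ρ'.im - γ| ≤ Xe * (L / (2 : ℝ) ^ (k - 1)) := by
      rw [div_le_iff₀ hτ0]
      calc X ^ (2 - ρ - (starRingEnd ℂ) ρ').re ≤ Xe := hXw
        _ = Xe * (L / (2 : ℝ) ^ (k - 1)) * ((2 : ℝ) ^ (k - 1) / L) := by field_simp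
        _ ≤ Xe * (L / (2 : ℝ) ^ (k - 1)) * |ρ'.im - γ| :=
            mul_le_mul_of_nonneg_left hlo.le (by positivity)
    have hmin : min 2 (4 / (|ρ'.im - γ| * ℓR)) ≤ min 2 (4 * L / ((2 : ℝ) ^ (k - 1) * ℓR)) := by
      refine min_le_min le_rfl ?_
      rw [div_le_div_iff₀ (by positivity) (by positivity)]
      have : (2 : ℝ) ^ (k - 1) * ℓR ≤ |ρ'.im - γ| * L * ℓR := by
        have := (div_lt_iff₀ hL0).1 hlo
        nlinarith
      nlinarith
    have hmin0 : 0 ≤ min 2 (4 / (|ρ'.im - γ| * ℓR)) := le_min (by norm_num) (by positivity)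
    calc 96 * π ^ 2 * X ^ (2 - ρ - (starRingEnd ℂ) ρ').re / |ρ'.im - γ| * (min 2 (4 / (|ρ'.im - γ| * ℓR))) ^ 2
        = 96 * π ^ 2 * (X ^ (2 - ρ - (starRingEnd ℂ) ρ').re / |ρ'.im - γ|) * (min 2 (4 / (|ρ'.im - γ| * ℓR))) ^ 2 := by
          ring
      _ ≤ 96 * π ^ 2 * (Xe * (L / (2 : ℝ) ^ (k - 1))) * (min 2 (4 * L / ((2 : ℝ) ^ (k - 1) * ℓR))) ^ 2 := by
          gcongr
      _ = _ := by ring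
  -- (iii) `|τ| > 1`
  set M₀ : ℕ := ⌊2 * T₀⌋₊ with hM₀
  have hpt2 : ∀ ρ' ∈ Z, 1 < |ρ'.im - γ| →
      ∃ m ∈ Icc 1 M₀, ((m : ℝ) < |ρ'.im - γ| ∧ |ρ'.im - γ| ≤ m + 1) ∧
        kernel X Y R J (2 - ρ - (starRingEnd ℂ) ρ') ≤ Bm m := by
    intro ρ' hρ' h1
    have hτT : |ρ'.im - γ| ≤ 2 * T₀ := by
      have := (hZ ρ' hρ').2.2
      calc |ρ'.im - γ| ≤ |ρ'.im| + |γ| := abs_sub _ _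
        _ ≤ T₀ + T₀ := add_le_add this hρim
        _ = 2 * T₀ := by ring
    obtain ⟨m, hm1, hmM, hlo, hhi⟩ := exists_unit_index h1 hτT
    refine ⟨m, mem_Icc.2 ⟨hm1, hmM⟩, ⟨hlo, hhi⟩, ?_⟩
    obtain ⟨hw0, hw1, hwε, hwim, hXw⟩ := hw ρ' hρ'
    refine (kernel_le_large hY1 hYX hR.le hJ hw0 hw1 (by rw [hwim]; exact h1.le)).trans ?_
    rw [hwim]
    simp only [hBm]
    have hfac : (1 + |ρ'.im - γ|) ^ (3 / 2 : ℝ) * Real.exp (-(π * |ρ'.im - γ|) / 2) ≤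
        ((2 : ℝ) + m) ^ (3 / 2 : ℝ) * Real.exp (-(π * m) / 2) := by
      refine mul_le_mul (Real.rpow_le_rpow (by positivity) (by linarith) (by norm_num))
        (Real.exp_le_exp.2 ?_) (Real.exp_nonneg _) (by positivity)
      have := Real.pi_pos
      nlinarith
    calc 128 * π ^ 2 * X ^ (2 - ρ - (starRingEnd ℂ) ρ').re *
          ((1 + |ρ'.im - γ|) ^ (3 / 2 : ℝ) * Real.exp (-(π * |ρ'.im - γ|) / 2))
        ≤ 128 * π ^ 2 * Xe * (((2 : ℝ) + m) ^ (3 / 2 : ℝ) * Real.exp (-(π * m) / 2)) := by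
          gcongr
      _ = _ := rfl
  /- ### split the row sum into the three ranges -/
  set f : ℂ → ℝ := fun ρ' => kernel X Y R J (2 - ρ - (starRingEnd ℂ) ρ') with hf
  set Z₀ := Z.filter (fun ρ' => |ρ'.im - γ| ≤ 1 / L) with hZ₀
  set Z₁ := (Z.filter (fun ρ' => ¬ |ρ'.im - γ| ≤ 1 / L)).filter (fun ρ' => |ρ'.im - γ| ≤ 1) with hZ₁
  set Z₂ := (Z.filter (fun ρ' => ¬ |ρ'.im - γ| ≤ 1 / L)).filter (fun ρ' => ¬ |ρ'.im - γ| ≤ 1) with hZ₂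
  have hsplit : ∑ ρ' ∈ Z, f ρ' = ∑ ρ' ∈ Z₀, f ρ' + ∑ ρ' ∈ Z₁, f ρ' + ∑ ρ' ∈ Z₂, f ρ' := by
    rw [hZ₀, hZ₁, hZ₂, ← sum_filter_add_sum_filter_not Z (fun ρ' => |ρ'.im - γ| ≤ 1 / L), add_assoc,
      ← sum_filter_add_sum_filter_not (Z.filter (fun ρ' => ¬ |ρ'.im - γ| ≤ 1 / L)) (fun ρ' => |ρ'.im - γ| ≤ 1)]
  -- (i)
  have hS0' : ∑ ρ' ∈ Z₀, f ρ' ≤ B₀ * (C_loc * (1 + (1 + lam) * (5 / 4))) := by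
    have hcard : (Z₀.card : ℝ) ≤ C_loc * (1 + (1 / L + lam / L) * (Real.log q + Real.log (|γ| + 4))) :=
      card_filter_near_le hloc hχ hL0 hlam hZre γ (by positivity) (by
        have : 1 / L ≤ 1 / 40 := one_div_le_one_div_of_le (by norm_num) hL40
        linarith)
    have hcard' : (Z₀.card : ℝ) ≤ C_loc * (1 + (1 + lam) * (5 / 4)) := by
      refine hcard.trans (mul_le_mul_of_nonneg_left ?_ hC_loc.le)
      have h1 : (1 / L + lam / L) * (Real.log q + Real.log (|γ| + 4)) ≤ (1 + lam) * (5 / 4) := by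
        rw [← hLdef]
        have : (1 / L + lam / L) * (L + Real.log (|γ| + 4)) ≤ (1 / L + lam / L) * (L + L / 4) :=
          mul_le_mul_of_nonneg_left (by linarith) (by positivity)
        have h2 : (1 / L + lam / L) * (L + L / 4) = (1 + lam) * (5 / 4) := by field_simp; ring
        linarith
      linarith
    calc ∑ ρ' ∈ Z₀, f ρ' ≤ ∑ ρ' ∈ Z₀, B₀ := sum_le_sum fun ρ' hρ' => by
          rw [hZ₀, mem_filter] at hρ'; exact hpt0 ρ' hρ'.1 hρ'.2
      _ = B₀ * Z₀.card := by rw [sum_const, nsmul_eq_mul, mul_comm]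
      _ ≤ B₀ * (C_loc * (1 + (1 + lam) * (5 / 4))) := mul_le_mul_of_nonneg_left hcard' hB₀0
  -- (ii)
  set C_cnt : ℝ := max C_loc (12 * C_w) with hC_cnt
  have hC_cnt0 : 0 ≤ C_cnt := le_max_of_le_left hC_loc.le
  have hcntk : ∀ k ∈ Icc 1 K₀,
      ((Z₁.filter (fun ρ' => (2 : ℝ) ^ (k - 1) / L < |ρ'.im - γ| ∧ |ρ'.im - γ| ≤ (2 : ℝ) ^ k / L)).card : ℝ) ≤
        C_cnt * (1 + (5 / 4) * (2 : ℝ) ^ k + (5 / 4) * lam) := by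
    intro k hk
    have h2k : 0 < (2 : ℝ) ^ k := by positivity
    rcases le_or_gt ((2 : ℝ) ^ k / L + lam / L) (1 / 4) with hsmall | hbig
    · -- local density with `δ = 2^k/L`
      have hsub : Z₁.filter (fun ρ' => (2 : ℝ) ^ (k - 1) / L < |ρ'.im - γ| ∧ |ρ'.im - γ| ≤ (2 : ℝ) ^ k / L) ⊆
          Z.filter (fun ρ' => |ρ'.im - γ| ≤ (2 : ℝ) ^ k / L) := by
        intro ρ' hρ'
        simp only [hZ₁, mem_filter] at hρ' ⊢
        exact ⟨hρ'.1.1.1, hρ'.2.2⟩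
      have hc := card_filter_near_le hloc hχ hL0 hlam hZre γ (by positivity : (0 : ℝ) < (2 : ℝ) ^ k / L) hsmall
      calc ((Z₁.filter _).card : ℝ) ≤ ((Z.filter (fun ρ' => |ρ'.im - γ| ≤ (2 : ℝ) ^ k / L)).card : ℝ) := by
            exact_mod_cast card_le_card hsub
        _ ≤ C_loc * (1 + ((2 : ℝ) ^ k / L + lam / L) * (Real.log q + Real.log (|γ| + 4))) := hc
        _ ≤ C_loc * (1 + (5 / 4) * (2 : ℝ) ^ k + (5 / 4) * lam) := by
            refine mul_le_mul_of_nonneg_left ?_ hC_loc.le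
            rw [← hLdef]
            have : ((2 : ℝ) ^ k / L + lam / L) * (L + Real.log (|γ| + 4)) ≤ ((2 : ℝ) ^ k / L + lam / L) * (L + L / 4) :=
              mul_le_mul_of_nonneg_left (by linarith) (by positivity)
            have h2 : ((2 : ℝ) ^ k / L + lam / L) * (L + L / 4) = (5 / 4) * (2 : ℝ) ^ k + (5 / 4) * lam := by
              field_simp; ring
            linarith
        _ ≤ C_cnt * (1 + (5 / 4) * (2 : ℝ) ^ k + (5 / 4) * lam) :=
            mul_le_mul_of_nonneg_right (le_max_left _ _) (by positivity)
    · -- windows: all of `Z₁` has `|τ| ≤ 1`, and `L < (16/3) 2^k`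
      have hsub : Z₁.filter (fun ρ' => (2 : ℝ) ^ (k - 1) / L < |ρ'.im - γ| ∧ |ρ'.im - γ| ≤ (2 : ℝ) ^ k / L) ⊆
          Z.filter (fun ρ' => |ρ'.im - γ| ≤ 1) := by
        intro ρ' hρ'
        simp only [hZ₁, mem_filter] at hρ' ⊢
        exact ⟨hρ'.1.1.1, hρ'.1.2⟩
      have hc := card_filter_one_le hC_w.le hwin hprim hq hZpos γ
      have hlog5 : Real.log (|γ| + 5) ≤ L / 4 + 1 := by
        have h1 : Real.log (|γ| + 5) ≤ Real.log ((|γ| + 4) * 2) :=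
          Real.log_le_log (by positivity) (by linarith [abs_nonneg γ])
        rw [Real.log_mul (by positivity) (by norm_num)] at h1
        have : Real.log 2 ≤ 1 := by have := Real.log_two_lt_d9; linarith
        linarith
      have hLk : L < 16 / 3 * (2 : ℝ) ^ k := by
        have h1 : (1 : ℝ) / 4 < (2 : ℝ) ^ k / L + lam / L := hbig
        have h2 : (2 : ℝ) ^ k / L + lam / L ≤ (2 : ℝ) ^ k / L + 1 / 16 := by linarith
        have h3 : (3 : ℝ) / 16 < (2 : ℝ) ^ k / L := by linarith
        rw [lt_div_iff₀ hL0] at h3; linarith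
      calc ((Z₁.filter _).card : ℝ) ≤ ((Z.filter (fun ρ' => |ρ'.im - γ| ≤ 1)).card : ℝ) := by
            exact_mod_cast card_le_card hsub
        _ ≤ 2 * C_w * (Real.log q + Real.log (|γ| + 5)) := hc
        _ ≤ 2 * C_w * (L + (L / 4 + 1)) := by rw [← hLdef]; gcongr
        _ ≤ 2 * C_w * (11 / 8 * L) := by
            refine mul_le_mul_of_nonneg_left ?_ (by positivity); linarith
        _ ≤ 2 * C_w * (11 / 8 * (16 / 3 * (2 : ℝ) ^ k)) := by gcongr
        _ = (44 / 3) * C_w * (2 : ℝ) ^ k := by ring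
        _ ≤ 12 * C_w * ((5 / 4) * (2 : ℝ) ^ k) := by nlinarith [hC_w.le, h2k.le]
        _ ≤ C_cnt * ((5 / 4) * (2 : ℝ) ^ k) := mul_le_mul_of_nonneg_right (le_max_right _ _) (by positivity)
        _ ≤ C_cnt * (1 + (5 / 4) * (2 : ℝ) ^ k + (5 / 4) * lam) := by
            refine mul_le_mul_of_nonneg_left ?_ hC_cnt0
            nlinarith
  have hS1 : ∑ ρ' ∈ Z₁, f ρ' ≤ 96 * π ^ 2 * Xe * C_cnt * L * (16 * (1 + (5 / 4) * lam) + 40 * L / ℓR) := by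
    have hlc := sum_le_sum_card_mul Z₁ (Icc 1 K₀) f Bk
      (fun k ρ' => (2 : ℝ) ^ (k - 1) / L < |ρ'.im - γ| ∧ |ρ'.im - γ| ≤ (2 : ℝ) ^ k / L)
      (fun k _ => hBk0 k) (fun ρ' hρ' => by
        simp only [hZ₁, mem_filter, not_le] at hρ'
        obtain ⟨k, hk, hcond, hle⟩ := hpt1 ρ' hρ'.1.1 hρ'.1.2 hρ'.2
        exact ⟨k, hk, hcond, hle⟩)
    refine hlc.trans ?_
    -- bound each term and sum the two series
    have hterm : ∀ k ∈ Icc 1 K₀, Bk k *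
        ((Z₁.filter (fun ρ' => (2 : ℝ) ^ (k - 1) / L < |ρ'.im - γ| ∧ |ρ'.im - γ| ≤ (2 : ℝ) ^ k / L)).card : ℝ) ≤
        96 * π ^ 2 * Xe * C_cnt * L * (8 * (1 + (5 / 4) * lam) * (2 : ℝ) ^ (1 - (k : ℤ)) +
          (5 / 2) * min 4 (64 * (L / ℓR) ^ 2 / (4 : ℝ) ^ k)) := by
      intro k hk
      have hk1 : 1 ≤ k := (mem_Icc.1 hk).1
      refine (mul_le_mul_of_nonneg_left (hcntk k hk) (hBk0 k)).trans ?_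
      simp only [hBk]
      have h2k : 0 < (2 : ℝ) ^ (k - 1) := by positivity
      -- `2^k = 2 · 2^{k-1}`, `L/2^{k-1} = 2 L 2^{-k}`... express everything via `a = 2^{k-1}`
      set a : ℝ := (2 : ℝ) ^ (k - 1) with ha
      have h2ka : (2 : ℝ) ^ k = 2 * a := by
        rw [ha, ← pow_succ']; congr 1; omega
      have hzpow : (2 : ℝ) ^ (1 - (k : ℤ)) = 1 / a := by
        rw [zpow_sub₀ (by norm_num), zpow_one, zpow_natCast, h2ka]
        field_simp
      have h4k : (4 : ℝ) ^ k = 4 * a ^ 2 := by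
        rw [show (4 : ℝ) = 2 ^ 2 by norm_num, ← pow_mul, pow_mul', h2ka]; ring
      rw [h2ka, hzpow, h4k]
      -- the `min` identity: `min 2 (4L/(aℓ))^2 = min 4 (16 L²/(a²ℓ²))`
      have hmin_sq : (min 2 (4 * L / (a * ℓR))) ^ 2 = min 4 (64 * (L / ℓR) ^ 2 / (4 * a ^ 2)) := by
        have hpos : 0 ≤ 4 * L / (a * ℓR) := by positivity
        rcases le_total 2 (4 * L / (a * ℓR)) with h | h
        · rw [min_eq_left h, min_eq_left]
          · norm_num
          · have : (2 : ℝ) ^ 2 ≤ (4 * L / (a * ℓR)) ^ 2 := pow_le_pow_left₀ (by norm_num) h 2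
            have e : (4 * L / (a * ℓR)) ^ 2 = 64 * (L / ℓR) ^ 2 / (4 * a ^ 2) := by field_simp; ring
            linarith
        · rw [min_eq_right h, min_eq_right]
          · field_simp; ring
          · have : (4 * L / (a * ℓR)) ^ 2 ≤ (2 : ℝ) ^ 2 := pow_le_pow_left₀ hpos h 2
            have e : (4 * L / (a * ℓR)) ^ 2 = 64 * (L / ℓR) ^ 2 / (4 * a ^ 2) := by field_simp; ring
            linarith
      rw [hmin_sq]
      set mu : ℝ := min 4 (64 * (L / ℓR) ^ 2 / (4 * a ^ 2)) with hmu
      have hmu0 : 0 ≤ mu := le_min (by norm_num) (by positivity)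
      have hmu4 : mu ≤ 4 := min_le_left _ _
      -- LHS = 96π²Xe (L/a) μ · C_cnt (1 + (5/4)(2a) + (5/4)λ)
      have hXe0 : 0 ≤ Xe := by linarith
      have key : (L / a) * mu * (1 + (5 / 4) * (2 * a) + (5 / 4) * lam) ≤
          L * (8 * (1 + (5 / 4) * lam) * (1 / a) + (5 / 2) * mu) := by
        have e : (L / a) * mu * (1 + (5 / 4) * (2 * a) + (5 / 4) * lam) =
            L * (mu * (1 + (5 / 4) * lam) * (1 / a) + (5 / 2) * mu) := by field_simp; ring
        rw [e]
        refine mul_le_mul_of_nonneg_left ?_ hL0.le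
        have h1a : 0 < 1 / a := by positivity
        have : mu * (1 + (5 / 4) * lam) * (1 / a) ≤ 4 * (1 + (5 / 4) * lam) * (1 / a) := by
          gcongr
        nlinarith
      calc 96 * π ^ 2 * Xe * (L / a) * mu * (C_cnt * (1 + 5 / 4 * (2 * a) + 5 / 4 * lam))
          = 96 * π ^ 2 * Xe * C_cnt * ((L / a) * mu * (1 + (5 / 4) * (2 * a) + (5 / 4) * lam)) := by ring
        _ ≤ 96 * π ^ 2 * Xe * C_cnt * (L * (8 * (1 + (5 / 4) * lam) * (1 / a) + (5 / 2) * mu)) :=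
            mul_le_mul_of_nonneg_left key (by positivity)
        _ = _ := by ring
    refine (sum_le_sum hterm).trans ?_
    rw [← mul_sum, sum_add_distrib, ← mul_sum, ← mul_sum]
    have hs1 := sum_two_pow_neg_le K₀
    have hs2 := sum_min_four_le (c := 64 * (L / ℓR) ^ 2) (by positivity) K₀
    have hsqrt : Real.sqrt (64 * (L / ℓR) ^ 2) = 8 * (L / ℓR) := by
      rw [show (64 : ℝ) * (L / ℓR) ^ 2 = (8 * (L / ℓR)) ^ 2 by ring, Real.sqrt_sq (by positivity)]
    rw [hsqrt] at hs2
    refine mul_le_mul_of_nonneg_left ?_ (by positivity)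
    have h0 : 0 ≤ 8 * (1 + (5 / 4) * lam) := by positivity
    calc 8 * (1 + 5 / 4 * lam) * ∑ k ∈ Icc 1 K₀, (2 : ℝ) ^ (1 - (k : ℤ)) +
          5 / 2 * ∑ k ∈ Icc 1 K₀, min 4 (64 * (L / ℓR) ^ 2 / (4 : ℝ) ^ k)
        ≤ 8 * (1 + 5 / 4 * lam) * 2 + 5 / 2 * (2 * (8 * (L / ℓR))) := by
          gcongr
      _ = 16 * (1 + 5 / 4 * lam) + 40 * L / ℓR := by ring
  -- (iii)
  have hS2 : ∑ ρ' ∈ Z₂, f ρ' ≤ 128 * π ^ 2 * Xe * (3 * C_w * L) * 10 := by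
    have hlc := sum_le_sum_card_mul Z₂ (Icc 1 M₀) f Bm
      (fun m ρ' => (m : ℝ) < |ρ'.im - γ| ∧ |ρ'.im - γ| ≤ m + 1)
      (fun m _ => hBm0 m) (fun ρ' hρ' => by
        simp only [hZ₂, mem_filter, not_le] at hρ'
        obtain ⟨m, hm, hcond, hle⟩ := hpt2 ρ' hρ'.1.1 hρ'.2
        exact ⟨m, hm, hcond, hle⟩)
    refine hlc.trans ?_
    have hterm : ∀ m ∈ Icc 1 M₀, Bm m *
        ((Z₂.filter (fun ρ' => (m : ℝ) < |ρ'.im - γ| ∧ |ρ'.im - γ| ≤ m + 1)).card : ℝ) ≤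
        128 * π ^ 2 * Xe * (3 * C_w * L) * (((2 : ℝ) + m) ^ (3 / 2 : ℝ) * Real.exp (-(π * m) / 2)) := by
      intro m hm
      have hm1 : (1 : ℝ) ≤ m := by exact_mod_cast (mem_Icc.1 hm).1
      have hmM : (m : ℝ) ≤ 2 * T₀ := by
        have h := (mem_Icc.1 hm).2
        have : (m : ℝ) ≤ ⌊2 * T₀⌋₊ := by exact_mod_cast h
        exact this.trans (Nat.floor_le (by positivity))
      have hsub : Z₂.filter (fun ρ' => (m : ℝ) < |ρ'.im - γ| ∧ |ρ'.im - γ| ≤ m + 1) ⊆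
          Z.filter (fun ρ' => (m : ℝ) < |ρ'.im - γ| ∧ |ρ'.im - γ| ≤ m + 1) := by
        intro ρ' hρ'
        simp only [hZ₂, mem_filter] at hρ' ⊢
        exact ⟨hρ'.1.1.1, hρ'.2⟩
      have hc := card_filter_unitShell_le hC_w.le hwin hprim hq hZpos γ (by linarith : (0 : ℝ) ≤ m)
      have hlogm : Real.log (|γ| + m + 5) ≤ L / 4 + 2 := by
        have h1 : |γ| + m + 5 ≤ (T₀ + 4) * 6 := by nlinarith [abs_nonneg γ]
        have h2 : Real.log (|γ| + m + 5) ≤ Real.log ((T₀ + 4) * 6) :=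
          Real.log_le_log (by positivity) h1
        rw [Real.log_mul (by positivity) (by norm_num)] at h2
        have h6 : Real.log 6 ≤ 2 := by
          rw [Real.log_le_iff_le_exp (by norm_num)]
          have e2 : Real.exp 2 = Real.exp 1 * Real.exp 1 := by rw [← Real.exp_add]; norm_num
          rw [e2]; nlinarith [Real.exp_one_gt_d9, Real.exp_pos (1 : ℝ)]
        linarith
      have hcard : ((Z₂.filter (fun ρ' => (m : ℝ) < |ρ'.im - γ| ∧ |ρ'.im - γ| ≤ m + 1)).card : ℝ) ≤
          3 * C_w * L := by
        calc ((Z₂.filter _).card : ℝ)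
            ≤ ((Z.filter (fun ρ' => (m : ℝ) < |ρ'.im - γ| ∧ |ρ'.im - γ| ≤ m + 1)).card : ℝ) := by
              exact_mod_cast card_le_card hsub
          _ ≤ 2 * C_w * (Real.log q + Real.log (|γ| + m + 5)) := hc
          _ ≤ 2 * C_w * (L + (L / 4 + 2)) := by rw [← hLdef]; gcongr
          _ ≤ 3 * C_w * L := by nlinarith [hC_w.le]
      calc Bm m * ((Z₂.filter _).card : ℝ) ≤ Bm m * (3 * C_w * L) := mul_le_mul_of_nonneg_left hcard (hBm0 m)
        _ = _ := by simp only [hBm]; ring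
    refine (sum_le_sum hterm).trans ?_
    rw [← mul_sum]
    exact mul_le_mul_of_nonneg_left (sum_rpow_mul_exp_le_ten M₀) (by positivity)
  /- ### conclusion -/
  rw [hsplit]
  have hXeL : 0 ≤ Xe * L := by positivity
  set S : ℝ := 1 + Real.log (X / Y) / L + L / ℓR with hS
  have hS1' : 1 ≤ S := by
    rw [hS]
    have : 0 ≤ Real.log (X / Y) / L := by positivity
    have : 0 ≤ L / ℓR := by positivity
    linarith
  have hS0 : 0 ≤ S := by linarith
  -- each of the three pieces is `≤ (constant) · Xe L (1 + λ) S`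
  have hT1 : B₀ * (C_loc * (1 + (1 + lam) * (5 / 4))) ≤ 432 * π ^ 2 * C_loc * (Xe * L * (1 + lam) * S) := by
    rw [hB₀]
    have h1 : 1 + (1 + lam) * (5 / 4) ≤ (9 / 4) * (1 + lam) := by nlinarith
    have h2 : Real.log (X / Y) ≤ L * S := by
      rw [hS]
      have : L * (1 + Real.log (X / Y) / L + L / ℓR) = L + Real.log (X / Y) + L * (L / ℓR) := by
        field_simp
      rw [this]
      have : 0 ≤ L * (L / ℓR) := by positivity
      linarith
    calc 192 * π ^ 2 * Real.log (X / Y) * Xe * (C_loc * (1 + (1 + lam) * (5 / 4)))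
        ≤ 192 * π ^ 2 * (L * S) * Xe * (C_loc * ((9 / 4) * (1 + lam))) := by gcongr
      _ = 432 * π ^ 2 * C_loc * (Xe * L * (1 + lam) * S) := by ring
  have hT2 : 96 * π ^ 2 * Xe * C_cnt * L * (16 * (1 + (5 / 4) * lam) + 40 * L / ℓR) ≤
      3840 * π ^ 2 * C_cnt * (Xe * L * (1 + lam) * S) := by
    have h1 : 16 * (1 + (5 / 4) * lam) + 40 * L / ℓR ≤ 40 * ((1 + lam) * S) := by
      rw [hS]
      have : 0 ≤ Real.log (X / Y) / L := by positivity
      have hLR : 0 ≤ L / ℓR := by positivity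
      have e : 40 * L / ℓR = 40 * (L / ℓR) := by ring
      rw [e]
      nlinarith
    calc 96 * π ^ 2 * Xe * C_cnt * L * (16 * (1 + (5 / 4) * lam) + 40 * L / ℓR)
        ≤ 96 * π ^ 2 * Xe * C_cnt * L * (40 * ((1 + lam) * S)) := by gcongr
      _ = 3840 * π ^ 2 * C_cnt * (Xe * L * (1 + lam) * S) := by ring
  have hT3 : 128 * π ^ 2 * Xe * (3 * C_w * L) * 10 ≤ 3840 * π ^ 2 * C_w * (Xe * L * (1 + lam) * S) := by
    have h1 : Xe * L ≤ Xe * L * (1 + lam) * S := by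
      have : 1 ≤ (1 + lam) * S := by nlinarith
      have e : Xe * L * (1 + lam) * S = (Xe * L) * ((1 + lam) * S) := by ring
      rw [e]; exact le_mul_of_one_le_right hXeL this
    calc 128 * π ^ 2 * Xe * (3 * C_w * L) * 10 = 3840 * π ^ 2 * C_w * (Xe * L) := by ring
      _ ≤ 3840 * π ^ 2 * C_w * (Xe * L * (1 + lam) * S) := mul_le_mul_of_nonneg_left h1 (by positivity)
  have hC_cnt_le : C_cnt ≤ C_loc + 12 * C_w := max_le (by nlinarith [hC_w.le]) (by nlinarith [hC_loc.le])
  have hmain : B₀ * (C_loc * (1 + (1 + lam) * (5 / 4))) +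
      96 * π ^ 2 * Xe * C_cnt * L * (16 * (1 + (5 / 4) * lam) + 40 * L / ℓR) +
      128 * π ^ 2 * Xe * (3 * C_w * L) * 10 ≤
      (π ^ 2 * (4272 * C_loc + 49920 * C_w) + 1) * (Xe * L * (1 + lam) * S) := by
    set P : ℝ := Xe * L * (1 + lam) * S with hPdef
    have hP : 0 ≤ P := by rw [hPdef]; positivity
    have h4 : 3840 * π ^ 2 * C_cnt * P ≤ 3840 * π ^ 2 * (C_loc + 12 * C_w) * P := by gcongr
    have h5 : 0 ≤ π ^ 2 * C_loc * P := by positivity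
    have h6 : 0 ≤ P := hP
    have e : (π ^ 2 * (4272 * C_loc + 49920 * C_w) + 1) * P =
        432 * π ^ 2 * C_loc * P + 3840 * π ^ 2 * (C_loc + 12 * C_w) * P + 3840 * π ^ 2 * C_w * P + P := by ring
    rw [e]
    linarith [hT1, hT2, hT3, h4]
  calc ∑ ρ' ∈ Z₀, f ρ' + ∑ ρ' ∈ Z₁, f ρ' + ∑ ρ' ∈ Z₂, f ρ'
      ≤ B₀ * (C_loc * (1 + (1 + lam) * (5 / 4))) +
        96 * π ^ 2 * Xe * C_cnt * L * (16 * (1 + (5 / 4) * lam) + 40 * L / ℓR) +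
        128 * π ^ 2 * Xe * (3 * C_w * L) * 10 := add_le_add (add_le_add hS0' hS1) hS2
    _ ≤ (π ^ 2 * (4272 * C_loc + 49920 * C_w) + 1) * (Xe * L * (1 + lam) * S) := hmain
    _ = _ := by rw [hXe, hε, hS, hℓR]; ring

end Literature.NumberTheory.LFunctions.LFDSingle
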